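/-
Copyright: seat `ym-line-cbag-p2` (prover-ym-line-cbag-p2-g0-0), route `ColdBoxAllGroups`, crux `BulkAllGroups`
(stmt-QuantumFields-22255), line `dlr-chessboard-G` (skeleton `Cruxes/BulkAllGroups/Lines/birth.lean`).
-/
import Summits.QuantumFields.YangMills.Theorems.ColdBoxAllGroupsBulkAllGroupsDlrPlumbingG
import Summits.QuantumFields.YangMills.Theorems.ColdBoxAllGroupsBoxFloorAllGroupsLargeFieldG
import Summits.QuantumFields.YangMills.Theorems.WeakCouplingRatesBulkDominatesColdBoxWNearCentreEdges

/-!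
# Crux `BulkAllGroups` (stmt-QuantumFields-22255): the box kernel's means of box-local gauge-invariant observables are unchanged when the datum
# is replaced by its TRUNCATED GAUGE COPY — any compact gauge group (H-A1-G); G-port of `…KernelTransport` + `…NearCentreEdges`

For the assembly of `KernelMeanExpansionG` / `KernelCovExpansionG`: the interfaces speak of `boxKernelG ρ β H ω` for the crude-good `ω`; the representation
will be written for the truncated gauge copy `ω₂ = glueWith E ((ω^g)|_E) 1`, `E = boxEdgesAt dirCorner (2H+3)` (the small-link datum of B4-G
`exists_gauge_opDist1_le_of_crudeGoodG`).  For every measurable, gauge-invariant observable `F` that reads only the links of the cold box `Λ`,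
`∫ F d(boxKernelG ρ β H ω) = ∫ F d(boxKernelG ρ β H ω₂)` (`integral_boxKernelG_eq_trunc_gauge`): the G-generic gauge covariance of the kernel
(`integral_ymSpecification_gaugeTransformZd`) and the collar congruence (`integral_ymSpecification_congr_collar`, `plaquetteEdges_subset_enlarged`, both
group-free).  Instances: one plaquette cost and the product of two (`integral_plaqCostAt(_mul)_boxKernelG_eq_trunc_gauge`), their near-centre forms
(`…_of_near_centre`, via the group-free `near_centre_plaquette_edges_mem`), observables of the enlarged box under weak locality, and the large-field event of
the collar (`measureReal_largeField_boxKernelG_eq_trunc_gauge`, so B5-G `boxKernelG_largeField_rarity_crudeGood` transfers to the charted configuration).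
No new definition; standard axioms.  NOT a claim about the mass gap; the Yang–Mills mass gap is NOT proved by any of this.
-/

set_option autoImplicit false

noncomputable section

open MeasureTheory Finset
open Literature.Probability.LatticeModels Literature.MathematicalPhysics.QuantumLattice
open Literature.MathematicalPhysics.QuantumFieldTheory Literature.MathematicalPhysics.QuantumFieldTheory.AxialGauge
open Literature.MathematicalPhysics.QuantumFieldTheory.LatticeMaxwell
open Summit.QuantumFields.YangMills.Theorems.WeakCouplingRates

namespace Summit.QuantumFields.YangMills.Theorems.ColdBoxAllGroups

variable {N : ℕ} {G : Type*} [Group G] [TopologicalSpace G] [IsTopologicalGroup G] [CompactSpace G]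
  [MeasurableSpace G] [BorelSpace G] [SecondCountableTopology G]
variable (ρ : G →* Matrix (Fin N) (Fin N) ℂ) (hρc : Continuous ρ)
include hρc

variable {H : ℕ}

/-- **Kernel means of box-local gauge-invariant observables are unchanged under `ω ↦` truncated gauge copy.** -/
theorem integral_boxKernelG_eq_trunc_gauge (β : ℝ) (H : ℕ) (ω : LGConfig 4 G)
    (g : Site 4 → G) {F : LGConfig 4 G → ℝ}
    (hF : Measurable F) (hFinv : IsZdGaugeInvariant F)
    (hFloc : ∀ (ζ : ↥(boxEdges 4 (2 * H + 1)) → G) (η η' : LGConfig 4 G),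
      F (glueWith (boxEdges 4 (2 * H + 1)) ζ η) = F (glueWith (boxEdges 4 (2 * H + 1)) ζ η')) :
    ∫ U, F U ∂(boxKernelG ρ β H ω) =
      ∫ U, F U ∂(boxKernelG ρ β H (glueWith (boxEdgesAt dirCorner (2 * H + 3))
        (fun e' : ↥(boxEdgesAt dirCorner (2 * H + 3)) => gaugeTransformZd g ω e'.1) (fun _ => 1))) := by
  unfold boxKernelG
  rw [← integral_ymSpecification_gaugeTransformZd ρ hρc β _ hF hFinv g ω]
  refine integral_ymSpecification_congr_collar ρ hρc β _ ?_ hF ?_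
  · intro p hp e he _
    rw [glueWith_apply_mem _ _ _ (plaquetteEdges_subset_enlarged hp he)]
  · intro ζ; exact hFloc ζ _ _

/-- **Transport of one plaquette mean**: for a plaquette whose four edges are box edges,
`E_{boxKernelG ρ β H ω}[c_p] = E_{boxKernelG ρ β H ω₂}[c_p]`, `ω₂` the truncated gauge copy. -/
theorem integral_plaqCostAt_boxKernelG_eq_trunc_gauge (β : ℝ) (H : ℕ) (ω : LGConfig 4 G)
    (g : Site 4 → G) {x : Site 4} {i j : Fin 4}
    (h1 : (x, i) ∈ boxEdges 4 (2 * H + 1)) (h2 : (x + Pi.single i 1, j) ∈ boxEdges 4 (2 * H + 1))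
    (h3 : (x + Pi.single j 1, i) ∈ boxEdges 4 (2 * H + 1)) (h4 : (x, j) ∈ boxEdges 4 (2 * H + 1)) :
    ∫ U, plaqCostAt ρ x i j U ∂(boxKernelG ρ β H ω) =
      ∫ U, plaqCostAt ρ x i j U ∂(boxKernelG ρ β H (glueWith (boxEdgesAt dirCorner (2 * H + 3))
        (fun e' : ↥(boxEdgesAt dirCorner (2 * H + 3)) => gaugeTransformZd g ω e'.1) (fun _ => 1))) :=
  integral_boxKernelG_eq_trunc_gauge ρ hρc β H ω g (measurable_plaqCostAtG ρ hρc x i j) (isZdGaugeInvariant_plaqCostAt _ x i j)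
    (fun ζ η η' => plaqCostAt_glueWith_eq ρ h1 h2 h3 h4 ζ η η')

/-- **Transport of the product of two plaquette costs** (both plaquettes with their four edges in the box). -/
theorem integral_plaqCostAt_mul_boxKernelG_eq_trunc_gauge (β : ℝ) (H : ℕ) (ω : LGConfig 4 G)
    (g : Site 4 → G) {x y : Site 4} {i j k l : Fin 4}
    (h1 : (x, i) ∈ boxEdges 4 (2 * H + 1)) (h2 : (x + Pi.single i 1, j) ∈ boxEdges 4 (2 * H + 1))
    (h3 : (x + Pi.single j 1, i) ∈ boxEdges 4 (2 * H + 1)) (h4 : (x, j) ∈ boxEdges 4 (2 * H + 1))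
    (h1' : (y, k) ∈ boxEdges 4 (2 * H + 1)) (h2' : (y + Pi.single k 1, l) ∈ boxEdges 4 (2 * H + 1))
    (h3' : (y + Pi.single l 1, k) ∈ boxEdges 4 (2 * H + 1)) (h4' : (y, l) ∈ boxEdges 4 (2 * H + 1)) :
    ∫ U, plaqCostAt ρ x i j U * plaqCostAt ρ y k l U ∂(boxKernelG ρ β H ω) =
      ∫ U, plaqCostAt ρ x i j U * plaqCostAt ρ y k l U
        ∂(boxKernelG ρ β H (glueWith (boxEdgesAt dirCorner (2 * H + 3))
          (fun e' : ↥(boxEdgesAt dirCorner (2 * H + 3)) => gaugeTransformZd g ω e'.1) (fun _ => 1))) :=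
  integral_boxKernelG_eq_trunc_gauge ρ hρc β H ω g ((measurable_plaqCostAtG ρ hρc x i j).mul (measurable_plaqCostAtG ρ hρc y k l))
    (isZdGaugeInvariant_plaqCostAt_mul _ x y i j k l)
    (fun ζ η η' => by
      rw [plaqCostAt_glueWith_eq ρ h1 h2 h3 h4 ζ η η',
        plaqCostAt_glueWith_eq ρ h1' h2' h3' h4' ζ η η'])

/-! ## Observables that read the ENLARGED box (e.g. the large-field event of the collar): weak locality suffices -/

/-- **Transport under weak locality**: it suffices that `F (glueWith Λ ζ η)` depends on `η` only through its links in the enlarged box `E`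
(e.g. observables of the plaquettes touching `Λ`). -/
theorem integral_boxKernelG_eq_trunc_gauge_of_enlarged (β : ℝ) (H : ℕ) (ω : LGConfig 4 G)
    (g : Site 4 → G) {F : LGConfig 4 G → ℝ}
    (hF : Measurable F) (hFinv : IsZdGaugeInvariant F)
    (hFloc : ∀ (ζ : ↥(boxEdges 4 (2 * H + 1)) → G) (η η' : LGConfig 4 G),
      (∀ e ∈ boxEdgesAt dirCorner (2 * H + 3), η e = η' e) →
        F (glueWith (boxEdges 4 (2 * H + 1)) ζ η) = F (glueWith (boxEdges 4 (2 * H + 1)) ζ η')) :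
    ∫ U, F U ∂(boxKernelG ρ β H ω) =
      ∫ U, F U ∂(boxKernelG ρ β H (glueWith (boxEdgesAt dirCorner (2 * H + 3))
        (fun e' : ↥(boxEdgesAt dirCorner (2 * H + 3)) => gaugeTransformZd g ω e'.1) (fun _ => 1))) := by
  unfold boxKernelG
  rw [← integral_ymSpecification_gaugeTransformZd ρ hρc β _ hF hFinv g ω]
  have hagree : ∀ e ∈ boxEdgesAt dirCorner (2 * H + 3), gaugeTransformZd g ω e =
      glueWith (boxEdgesAt dirCorner (2 * H + 3))
        (fun e' : ↥(boxEdgesAt dirCorner (2 * H + 3)) => gaugeTransformZd g ω e'.1) (fun _ => 1) e := fun e he => by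
    rw [glueWith_apply_mem _ _ _ he]
  refine integral_ymSpecification_congr_collar ρ hρc β _ ?_ hF ?_
  · intro p hp e he _
    exact hagree e (plaquetteEdges_subset_enlarged hp he)
  · intro ζ; exact hFloc ζ _ _ hagree

/-- **Transport of probabilities of gauge-invariant events reading the enlarged box.** -/
theorem measureReal_boxKernelG_eq_trunc_gauge_of_enlarged (β : ℝ) (H : ℕ) (ω : LGConfig 4 G)
    (g : Site 4 → G) {s : Set (LGConfig 4 G)}
    (hs : MeasurableSet s) (hsinv : ∀ (g' : Site 4 → G) U, gaugeTransformZd g' U ∈ s ↔ U ∈ s)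
    (hsloc : ∀ (ζ : ↥(boxEdges 4 (2 * H + 1)) → G) (η η' : LGConfig 4 G),
      (∀ e ∈ boxEdgesAt dirCorner (2 * H + 3), η e = η' e) →
        (glueWith (boxEdges 4 (2 * H + 1)) ζ η ∈ s ↔ glueWith (boxEdges 4 (2 * H + 1)) ζ η' ∈ s)) :
    (boxKernelG ρ β H ω).real s =
      (boxKernelG ρ β H (glueWith (boxEdgesAt dirCorner (2 * H + 3))
        (fun e' : ↥(boxEdgesAt dirCorner (2 * H + 3)) => gaugeTransformZd g ω e'.1) (fun _ => 1))).real s := by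
  rw [← integral_indicator_one hs, ← integral_indicator_one hs]
  refine integral_boxKernelG_eq_trunc_gauge_of_enlarged ρ hρc β H ω g (measurable_const.indicator hs) ?_ ?_
  · intro g' U
    by_cases hU : U ∈ s
    · rw [Set.indicator_of_mem hU, Set.indicator_of_mem ((hsinv g' U).2 hU)]; rfl
    · rw [Set.indicator_of_notMem hU, Set.indicator_of_notMem (fun h => hU ((hsinv g' U).1 h))]
  · intro ζ η η' hη
    by_cases hU : glueWith (boxEdges 4 (2 * H + 1)) ζ η ∈ s
    · rw [Set.indicator_of_mem hU, Set.indicator_of_mem ((hsloc ζ η η' hη).1 hU)]; rfl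
    · rw [Set.indicator_of_notMem hU, Set.indicator_of_notMem (fun h => hU ((hsloc ζ η η' hη).2 h))]

/-- **The large-field event of the collar has the same kernel probability at `ω` and at its truncated gauge copy** — so the YM-side rarity
`boxKernel_largeField_rarity_crudeGood` (stated for crude-good `ω`) transfers to the charted configuration of the assembly. -/
theorem measureReal_largeField_boxKernelG_eq_trunc_gauge (β s : ℝ) (H : ℕ) (ω : LGConfig 4 G)
    (g : Site 4 → G) :
    (boxKernelG ρ β H ω).real {U | ∃ p ∈ plaquettesTouching (boxEdges 4 (2 * H + 1)),
        s ≤ (N : ℝ) - plaquetteObs ρ p.1 p.2.1.1 p.2.1.2 U} =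
      (boxKernelG ρ β H (glueWith (boxEdgesAt dirCorner (2 * H + 3))
        (fun e' : ↥(boxEdgesAt dirCorner (2 * H + 3)) => gaugeTransformZd g ω e'.1) (fun _ => 1))).real
        {U | ∃ p ∈ plaquettesTouching (boxEdges 4 (2 * H + 1)),
          s ≤ (N : ℝ) - plaquetteObs ρ p.1 p.2.1.1 p.2.1.2 U} := by
  refine measureReal_boxKernelG_eq_trunc_gauge_of_enlarged ρ hρc β H ω g (measurableSet_exists_plaqCost_ge_of_rep ρ hρc _ s) ?_ ?_
  · intro g' U
    simp only [Set.mem_setOf_eq, isZdGaugeInvariant_plaquetteObs ρ _ _ _ g' U]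
  · intro ζ η η' hη
    have hkey : ∀ p ∈ plaquettesTouching (boxEdges 4 (2 * H + 1)),
        plaquetteObs ρ p.1 p.2.1.1 p.2.1.2 (glueWith (boxEdges 4 (2 * H + 1)) ζ η) =
          plaquetteObs ρ p.1 p.2.1.1 p.2.1.2 (glueWith (boxEdges 4 (2 * H + 1)) ζ η') := by
      intro p hp
      have hlink : ∀ e ∈ plaquetteEdges p, glueWith (boxEdges 4 (2 * H + 1)) ζ η e = glueWith (boxEdges 4 (2 * H + 1)) ζ η' e := by
        intro e he
        by_cases heΛ : e ∈ boxEdges 4 (2 * H + 1)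
        · rw [glueWith_apply_mem _ _ _ heΛ, glueWith_apply_mem _ _ _ heΛ]
        · rw [glueWith_apply_not_mem _ _ _ heΛ, glueWith_apply_not_mem _ _ _ heΛ, hη e (plaquetteEdges_subset_enlarged hp he)]
      refine plaquetteObs_congr_links ρ p.1 p.2.1.1 p.2.1.2 ?_ ?_ ?_ ?_ <;> apply hlink <;>
        simp [plaquetteEdges]
    simp only [Set.mem_setOf_eq]
    constructor
    · rintro ⟨p, hp, h⟩; exact ⟨p, hp, by rwa [← hkey p hp]⟩
    · rintro ⟨p, hp, h⟩; exact ⟨p, hp, by rwa [hkey p hp]⟩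


/-! ## Near-centre plaquettes (the plaquettes of the interfaces) -/

/-- **Transport of the kernel mean of a near-centre plaquette cost** to the truncated gauge copy of the datum. -/
theorem integral_plaqCostAt_boxKernelG_eq_trunc_gauge_of_near_centre (β : ℝ) {H : ℕ} (hH : 1 ≤ H)
    (ω : LGConfig 4 G) (g : Site 4 → G)
    {x : Site 4} (hx : ∀ m : Fin 4, 8 * |x m - (H : ℤ)| ≤ (H : ℤ)) {i j : Fin 4} (hij : i ≠ j) :
    ∫ U, plaqCostAt ρ x i j U ∂(boxKernelG ρ β H ω) =
      ∫ U, plaqCostAt ρ x i j U ∂(boxKernelG ρ β H (glueWith (boxEdgesAt dirCorner (2 * H + 3))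
        (fun e' : ↥(boxEdgesAt dirCorner (2 * H + 3)) => gaugeTransformZd g ω e'.1) (fun _ => 1))) := by
  obtain ⟨h1, h2, h3, h4⟩ := near_centre_plaquette_edges_mem hH hx hij
  exact integral_plaqCostAt_boxKernelG_eq_trunc_gauge ρ hρc β H ω g h1 h2 h3 h4

/-- **Transport of the kernel two-point integral of two near-centre plaquette costs.** -/
theorem integral_plaqCostAt_mul_boxKernelG_eq_trunc_gauge_of_near_centre (β : ℝ) {H : ℕ} (hH : 1 ≤ H)
    (ω : LGConfig 4 G) (g : Site 4 → G)
    {x y : Site 4} (hx : ∀ m : Fin 4, 8 * |x m - (H : ℤ)| ≤ (H : ℤ)) (hy : ∀ m : Fin 4, 8 * |y m - (H : ℤ)| ≤ (H : ℤ))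
    {i j k l : Fin 4} (hij : i ≠ j) (hkl : k ≠ l) :
    ∫ U, plaqCostAt ρ x i j U * plaqCostAt ρ y k l U ∂(boxKernelG ρ β H ω) =
      ∫ U, plaqCostAt ρ x i j U * plaqCostAt ρ y k l U
        ∂(boxKernelG ρ β H (glueWith (boxEdgesAt dirCorner (2 * H + 3))
          (fun e' : ↥(boxEdgesAt dirCorner (2 * H + 3)) => gaugeTransformZd g ω e'.1) (fun _ => 1))) := by
  obtain ⟨h1, h2, h3, h4⟩ := near_centre_plaquette_edges_mem hH hx hij
  obtain ⟨h1', h2', h3', h4'⟩ := near_centre_plaquette_edges_mem hH hy hkl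
  exact integral_plaqCostAt_mul_boxKernelG_eq_trunc_gauge ρ hρc β H ω g h1 h2 h3 h4 h1' h2' h3' h4'

end Summit.QuantumFields.YangMills.Theorems.ColdBoxAllGroups

end
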